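import Summits.RiemannHypothesis.RiemannHypothesis.Theorems.HandoffFailingStep
import HarnessLib

/-!
# The WALL SEQUENCE `q ↦ a*({p < q})`: frozen past the failing prime under `¬RH`, unbounded iff RH — a rate-free
# criterion, and first-gap locality of the semi-local landscape (cell `rh-explicit`, TRACK «HANDOFF», file XII)

Seat handoff-theory-1 (H-T, statement owner), gen6.  Companion text `HOME/handoff/HANDOFF-STATEMENT.md` §J.16.
Everything here is KERNEL bookkeeping on top of tree theorems (Yoshida's threshold `a₀ = weilPositivityThreshold`,
the semi-local threshold `a*(S) = weilSemilocalThreshold S` with its locality/coincidence lemmas, file X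
`HandoffFailingStep`); no new analysis.  Nothing here is a step towards RH.

The cell's A4 table measures the WALL SEQUENCE `W(N) := a*({p < N}) = weilSemilocalThreshold (Nat.primesBelow N)`
(for a prime `q`, `W(q) = a*(S_q)`, `S_q = {p < q}`; the wall offset is `δ*(q) = W(q) − (log q)/2`).  The tree knows
`RH ↔ ∀ N, (log (N+1))/2 ≤ W(N+1)` (`riemannHypothesis_iff_forall_le_weilSemilocalThreshold`) and, under `¬RH`,
`min (a*(S)) L = min a₀ L` below the coincidence window (`min_weilSemilocalThreshold_eq`).  This file reads off:

* §1 DICTIONARY `IsWeilOnset a₀ → a₀ = weilPositivityThreshold` (file X's onset IS Yoshida's number).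
* §2 THE FREEZE (under `¬RH`): every finite `S` containing the primes `≤ M` with `(log (M+1))/2 > a₀` has
  `a*(S) = a₀` EXACTLY (`weilSemilocalThreshold_eq_threshold_of_lt`); in particular `W(N) = a₀` for every `N` past the
  onset, and — in file X's language — if the increment fails at the prime `q₁` then `W(N) = a₀` for EVERY `N > q₁`
  while `(log N)/2 ≤ W(N)` for `N ≤ q₁`, with `(log q₁)/2 ≤ a₀ < (log q₁⁺)/2`: the table would RISE up to the failing
  prime and then FREEZE inside the failing window forever.  Unconditionally: `(log N)/2 ≤ a₀ → (log N)/2 ≤ W(N)`.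
* §3 THE RATE-FREE CRITERION: `RH ↔ ∀ T, ∃ N, T ≤ W(N)` (`riemannHypothesis_iff_forall_exists_le_wall`) `↔ W → ∞`
  (`riemannHypothesis_iff_tendsto_wall_atTop`) `↔ W is not eventually constant`
  (`riemannHypothesis_iff_not_wall_eventuallyConst`); the unconditional DICHOTOMY `RH ∨ (W eventually ≡ a₀)`; and
  `riemannHypothesis_of_frequently_le_wall`: ANY divergent minorant met infinitely often gives RH.  READING: there is
  no intermediate growth — the walls either dominate `(log q)/2` at every prime or stop moving; so «the semi-local
  walls are unbounded» is an exact REFORMULATION of RH (the wall-language twin of the tree's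
  `weilGroundEnergy_dichotomy`), not a weaker sufficient condition.
* §4 FIRST-GAP LOCALITY (RH-free): if `q` is the least prime missing from a finite `S` and the cell's UPPER clause
  `UC(q) : a*(S_q) < (log q⁺)/2` holds at `q`, then `a*(S) = a*(S_q)` (`weilSemilocalThreshold_eq_of_firstGap`; the
  tree has the instances `q = 2, 3, 5, 7, 11, 13` with kernel UC rows: `weilSemilocalThreshold_eq_empty_of_two_not_mem`,
  `_eq_two`, `_eq_twoThree`, `_eq_twoThreeFive`, `_eq_uptoSeven`, `_eq_uptoEleven`).  Hence under `∀ q, UC(q)`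
  (CERTIFIED as data for `5 ≤ q ≤ 73`, OPEN beyond; used only as a named hypothesis) the whole semi-local landscape
  `{a*(S) : S finite}` IS the wall sequence, and `RH ↔ sup_S a*(S) = ∞`
  (`riemannHypothesis_iff_forall_exists_finset_le_wall_of_upperClause`).

References: H. Yoshida, Adv. Stud. Pure Math. 21 (1992), Thm 1 p. 310, Prop. 6 p. 320 (`Yoshida1992HermitianForms`);
E. Bombieri, Rend. Mat. Acc. Lincei (9) 11 (2000), Thm 2 / §4 (`Bombieri2000Weil`); A. Connes, C. Consani, 2023,
§2.1.2 (semi-local form: only the primes `p < λ²` enter; `ConnesConsani2023`).  The wall-sequence statements are, as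
far as searched (tree API; cell files LADDER-R3.md, HANDOFF-STATEMENT.md §B.4–§B.5), not in print: theorems about the
tree's objects, labelled PROVED-new, not literature.
-/

set_option linter.dupNamespace false  -- the mandated namespace repeats `RiemannHypothesis`

noncomputable section

open Set Filter Literature.NumberTheory.LFunctions
open Summit.RiemannHypothesis.RiemannHypothesis.Theorems.MotivicDoor.Semilocal
open Summit.RiemannHypothesis.RiemannHypothesis.Theorems.MotivicDoor.SemilocalThreshold
open scoped Topology

namespace Summit.RiemannHypothesis.RiemannHypothesis.Theorems

/-! ## §1 Dictionary: the onset is Yoshida's threshold -/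

/-- File X's onset window IS Yoshida's number: `IsWeilOnset a₀ → a₀ = weilPositivityThreshold`.
[cite: Yoshida1992HermitianForms, Prop. 6 (p. 320)] -/
theorem IsWeilOnset.eq_weilPositivityThreshold {a₀ : ℝ} (h : IsWeilOnset a₀) :
    a₀ = weilPositivityThreshold := by
  have hY := Yoshida1992_prop6 h.not_riemannHypothesis
  have hpos : 0 < weilPositivityThreshold :=
    lt_of_lt_of_le (by positivity) hY.1
  apply le_antisymm
  · -- positivity holds AT `a₀`, so `a₀` is not beyond Yoshida's threshold
    by_contra hlt
    rw [not_le] at hlt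
    exact hY.2.2 a₀ hlt ((h.weilPositivityOn_iff h.pos).2 le_rfl)
  · exact h.le_of_weilPositivityOn (hY.2.1 _ le_rfl)

namespace HandoffDecomposition

variable {q q₁ N M : ℕ} {S : Finset ℕ}

/-! ## §2 The freeze under `¬RH` -/

/-- **THE FREEZE.** Under `¬RH`: every finite `S` containing (the prime factors of every prime power) `≤ M`, with the
coincidence window `(log (M+1))/2` strictly beyond Yoshida's `a₀`, has `a*(S) = a₀` EXACTLY.
[cite: Yoshida1992HermitianForms, Prop. 6 (p. 320)] -/
theorem weilSemilocalThreshold_eq_threshold_of_lt (hRH : ¬ Summit.RiemannHypothesis)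
    (hS : ∀ n ≤ M, IsPrimePow n → n.primeFactors ⊆ S)
    (hM : weilPositivityThreshold < Real.log ((M : ℝ) + 1) / 2) :
    weilSemilocalThreshold S = weilPositivityThreshold := by
  have hmin := min_weilSemilocalThreshold_eq hRH hS
  rw [min_eq_left hM.le] at hmin
  have hlt : weilSemilocalThreshold S < Real.log ((M : ℝ) + 1) / 2 := by
    by_contra hle
    rw [not_lt] at hle
    rw [min_eq_right hle] at hmin
    exact hM.ne' hmin
  rwa [min_eq_left hlt.le] at hmin

/-- Every prime power `≤ M` is `{p < N}`-smooth as soon as `M < N`. [folklore] -/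
theorem primeFactors_subset_primesBelow_of_lt (hMN : M < N) :
    ∀ n ≤ M, IsPrimePow n → n.primeFactors ⊆ Nat.primesBelow N := fun _ hn _ _ hp ↦
  Nat.mem_primesBelow.2
    ⟨lt_of_le_of_lt ((Nat.le_of_mem_primeFactors hp).trans hn) hMN, Nat.prime_of_mem_primeFactors hp⟩

/-- Yoshida's threshold is positive under `¬RH`. [cite: Yoshida1992HermitianForms, Thm. 1 (p. 310), Prop. 6 (p. 320)] -/
theorem weilPositivityThreshold_pos (hRH : ¬ Summit.RiemannHypothesis) : 0 < weilPositivityThreshold :=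
  lt_of_lt_of_le (by positivity) (Yoshida1992_prop6 hRH).1

/-- **The wall sequence freezes past the onset**: under `¬RH`, `a₀ < (log N)/2 → W(N) = a*({p < N}) = a₀`.
[cite: Yoshida1992HermitianForms, Prop. 6 (p. 320)] -/
theorem wall_eq_threshold_of_lt (hRH : ¬ Summit.RiemannHypothesis)
    (hN : weilPositivityThreshold < Real.log (N : ℝ) / 2) :
    weilSemilocalThreshold (Nat.primesBelow N) = weilPositivityThreshold := by
  have h1 : 1 ≤ N := by
    by_contra h0
    have hN0 : N = 0 := by omega
    subst hN0
    simp only [Nat.cast_zero, Real.log_zero, zero_div] at hN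
    exact absurd hN (not_lt.2 (weilPositivityThreshold_pos hRH).le)
  obtain ⟨M, rfl⟩ : ∃ M, N = M + 1 := ⟨N - 1, (Nat.sub_add_cancel h1).symm⟩
  push_cast at hN
  exact weilSemilocalThreshold_eq_threshold_of_lt hRH
    (primeFactors_subset_primesBelow_of_lt (Nat.lt_succ_self M)) hN

/-- **Before the onset the walls rise** — UNCONDITIONALLY: `(log N)/2 ≤ a₀ → (log N)/2 ≤ W(N)` (under `¬RH` by the
`min`-identity; under RH the conclusion holds for every `N`, and `a₀` is then the junk value of an unbounded `sSup`).
[cite: Yoshida1992HermitianForms, Prop. 6 (p. 320); Bombieri2000Weil, Thm. 2] -/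
theorem log_half_le_wall_of_le_threshold (hN : Real.log (N : ℝ) / 2 ≤ weilPositivityThreshold) :
    Real.log (N : ℝ) / 2 ≤ weilSemilocalThreshold (Nat.primesBelow N) := by
  rcases Nat.eq_zero_or_pos N with rfl | hpos
  · simp only [Nat.cast_zero, Real.log_zero, zero_div]
    exact (weilSemilocalThreshold_pos _).le
  obtain ⟨M, rfl⟩ : ∃ M, N = M + 1 := ⟨N - 1, (Nat.sub_add_cancel hpos).symm⟩
  push_cast at hN ⊢
  have hS := primeFactors_subset_primesBelow_of_lt (N := M + 1) (Nat.lt_succ_self M)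
  by_cases hRH : Summit.RiemannHypothesis
  · exact le_weilSemilocalThreshold_of_riemannHypothesis hRH hS
  · have hmin := min_weilSemilocalThreshold_eq hRH hS
    rw [min_eq_right hN] at hmin
    exact min_eq_right_iff.1 hmin

/-- For `q₁ < N`, every prime power `≤ q₁⁺ − 1` is `{p < N}`-smooth (no prime lies in `(q₁, q₁⁺)`). [folklore] -/
theorem primeFactors_subset_primesBelow_of_failing (hN : q₁ < N) :
    ∀ n ≤ nextPrime q₁ - 1, IsPrimePow n → n.primeFactors ⊆ Nat.primesBelow N := by
  intro n hn _ p hp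
  have hp' : p.Prime := Nat.prime_of_mem_primeFactors hp
  have hple : p ≤ q₁ := by
    by_contra hlt
    rw [not_le] at hlt
    have h1 := nextPrime_le hp' hlt
    have h2 : p ≤ nextPrime q₁ - 1 := (Nat.le_of_mem_primeFactors hp).trans hn
    have h3 := (nextPrime_prime q₁).one_lt
    omega
  exact Nat.mem_primesBelow.2 ⟨lt_of_le_of_lt hple hN, hp'⟩

/-- **THE TABLE UNDER `¬RH`, past the failing prime**: if the increment fails at the prime `q₁` then EVERY later
wall is frozen at Yoshida's `a₀`: `W(N) = a₀` for all `N > q₁`. [this track (theory-1); Yoshida1992HermitianForms, Prop. 6 (p. 320)] -/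
theorem wall_eq_threshold_of_not_handoffStep (hq₁ : q₁.Prime) (hfail : ¬ HandoffStep q₁) (hN : q₁ < N) :
    weilSemilocalThreshold (Nat.primesBelow N) = weilPositivityThreshold := by
  have hRH : ¬ Summit.RiemannHypothesis := fun h ↦ hfail (riemannHypothesis_iff_forall_handoffStep.1 h q₁ hq₁)
  obtain ⟨a₀, ha₀⟩ := exists_isWeilOnset_of_not_riemannHypothesis hRH
  have hwin := (ha₀.not_handoffStep_iff hq₁).1 hfail
  rw [ha₀.eq_weilPositivityThreshold] at hwin
  refine weilSemilocalThreshold_eq_threshold_of_lt hRH (primeFactors_subset_primesBelow_of_failing hN) ?_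
  have h1 := (nextPrime_prime q₁).one_lt.le
  rw [show ((nextPrime q₁ - 1 : ℕ) : ℝ) + 1 = nextPrime q₁ by exact_mod_cast Nat.sub_add_cancel h1]
  exact hwin.2

/-- **… and up to the failing prime the walls rise**: `¬H′(q₁) → N ≤ q₁ → (log N)/2 ≤ W(N)`. [this track (theory-1)] -/
theorem log_half_le_wall_of_not_handoffStep (hq₁ : q₁.Prime) (hfail : ¬ HandoffStep q₁) (hN : N ≤ q₁) :
    Real.log (N : ℝ) / 2 ≤ weilSemilocalThreshold (Nat.primesBelow N) := by
  rcases Nat.eq_zero_or_pos N with rfl | hpos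
  · simp only [Nat.cast_zero, Real.log_zero, zero_div]
    exact (weilSemilocalThreshold_pos _).le
  have hRH : ¬ Summit.RiemannHypothesis := fun h ↦ hfail (riemannHypothesis_iff_forall_handoffStep.1 h q₁ hq₁)
  obtain ⟨a₀, ha₀⟩ := exists_isWeilOnset_of_not_riemannHypothesis hRH
  have hwin := (ha₀.not_handoffStep_iff hq₁).1 hfail
  rw [ha₀.eq_weilPositivityThreshold] at hwin
  refine log_half_le_wall_of_le_threshold (le_trans ?_ hwin.1)
  have h0 : (0 : ℝ) < N := by exact_mod_cast hpos
  have h1 : (N : ℝ) ≤ q₁ := by exact_mod_cast hN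
  linarith [Real.log_le_log h0 h1]

/-- **The frozen value sits in the failing window**: `¬H′(q₁) → (log q₁)/2 ≤ a₀ < (log q₁⁺)/2`.
[this track (theory-1); Yoshida1992HermitianForms, Prop. 6 (p. 320)] -/
theorem threshold_mem_window_of_not_handoffStep (hq₁ : q₁.Prime) (hfail : ¬ HandoffStep q₁) :
    Real.log q₁ / 2 ≤ weilPositivityThreshold ∧ weilPositivityThreshold < Real.log (nextPrime q₁) / 2 := by
  have hRH : ¬ Summit.RiemannHypothesis := fun h ↦ hfail (riemannHypothesis_iff_forall_handoffStep.1 h q₁ hq₁)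
  obtain ⟨a₀, ha₀⟩ := exists_isWeilOnset_of_not_riemannHypothesis hRH
  have hwin := (ha₀.not_handoffStep_iff hq₁).1 hfail
  rwa [ha₀.eq_weilPositivityThreshold] at hwin

/-- **THE WHOLE TABLE UNDER A FAILED INCREMENT AT `q₁`** (the two regimes together): for every `N`, either `N ≤ q₁`
and the wall dominates its window, `(log N)/2 ≤ W(N)` (RISE), or `N > q₁` and `W(N) = a₀` (FREEZE, with
`(log q₁)/2 ≤ a₀ < (log q₁⁺)/2` by `threshold_mem_window_of_not_handoffStep`). [this track (theory-1)] -/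
theorem wall_dichotomy_of_not_handoffStep (hq₁ : q₁.Prime) (hfail : ¬ HandoffStep q₁) (N : ℕ) :
    (N ≤ q₁ ∧ Real.log (N : ℝ) / 2 ≤ weilSemilocalThreshold (Nat.primesBelow N)) ∨
      (q₁ < N ∧ weilSemilocalThreshold (Nat.primesBelow N) = weilPositivityThreshold) := by
  rcases le_or_gt N q₁ with h | h
  · exact Or.inl ⟨h, log_half_le_wall_of_not_handoffStep hq₁ hfail h⟩
  · exact Or.inr ⟨h, wall_eq_threshold_of_not_handoffStep hq₁ hfail h⟩

/-! ## §3 The rate-free criterion: RH iff the walls are unbounded -/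

/-- `2T ≤ log (⌈e^{2T}⌉₊ + 1)`: the window `T` is below the coincidence window of `N = ⌈e^{2T}⌉₊`. [folklore] -/
theorem le_log_half_ceil_exp (T : ℝ) : T ≤ Real.log ((⌈Real.exp (2 * T)⌉₊ : ℝ) + 1) / 2 := by
  have h1 : Real.exp (2 * T) ≤ (⌈Real.exp (2 * T)⌉₊ : ℝ) + 1 :=
    (Nat.le_ceil _).trans (le_add_of_nonneg_right zero_le_one)
  have h0 : (0 : ℝ) < (⌈Real.exp (2 * T)⌉₊ : ℝ) + 1 := by positivity
  have h2 : 2 * T ≤ Real.log ((⌈Real.exp (2 * T)⌉₊ : ℝ) + 1) := by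
    rw [Real.le_log_iff_exp_le h0]
    exact h1
  linarith

/-- **RH ⟺ THE WALLS ARE UNBOUNDED**: `RH ↔ ∀ T, ∃ N, T ≤ a*({p < N})`.  (⇒) the tree's
`RH → (log (N+1))/2 ≤ W(N+1)`; (⇐) under `¬RH` the walls freeze at `a₀` past `e^{2a₀}` (§2) and only finitely many
come before. A criterion WITHOUT A RATE — because there is no intermediate growth. [this track (theory-1); Yoshida1992HermitianForms, Prop. 6 (p. 320); Bombieri2000Weil, Thm. 2] -/
theorem riemannHypothesis_iff_forall_exists_le_wall :
    Summit.RiemannHypothesis ↔ ∀ T : ℝ, ∃ N : ℕ, T ≤ weilSemilocalThreshold (Nat.primesBelow N) := by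
  constructor
  · intro hRH T
    refine ⟨⌈Real.exp (2 * T)⌉₊ + 1, (le_log_half_ceil_exp T).trans ?_⟩
    have := riemannHypothesis_iff_forall_le_weilSemilocalThreshold.1 hRH ⌈Real.exp (2 * T)⌉₊
    exact_mod_cast this
  · intro h
    by_contra hRH
    -- the bound: `a₀ + 1` plus every wall before the freeze (`K = ⌈e^{2a₀}⌉₊`)
    have hsum : 0 ≤ ∑ i ∈ Finset.range (⌈Real.exp (2 * weilPositivityThreshold)⌉₊ + 1),
        weilSemilocalThreshold (Nat.primesBelow i) :=
      Finset.sum_nonneg fun i _ ↦ (weilSemilocalThreshold_pos _).le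
    obtain ⟨N, hN⟩ := h (weilPositivityThreshold + 1 +
      ∑ i ∈ Finset.range (⌈Real.exp (2 * weilPositivityThreshold)⌉₊ + 1),
        weilSemilocalThreshold (Nat.primesBelow i))
    rcases le_or_gt N ⌈Real.exp (2 * weilPositivityThreshold)⌉₊ with hle | hgt
    · -- a wall before the freeze is one of the summands
      have hmem : N ∈ Finset.range (⌈Real.exp (2 * weilPositivityThreshold)⌉₊ + 1) :=
        Finset.mem_range.2 (Nat.lt_succ_of_le hle)
      have h1 : weilSemilocalThreshold (Nat.primesBelow N) ≤
          ∑ i ∈ Finset.range (⌈Real.exp (2 * weilPositivityThreshold)⌉₊ + 1),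
            weilSemilocalThreshold (Nat.primesBelow i) :=
        Finset.single_le_sum (f := fun i ↦ weilSemilocalThreshold (Nat.primesBelow i))
          (fun i _ ↦ (weilSemilocalThreshold_pos _).le) hmem
      have h2 := weilPositivityThreshold_pos hRH
      linarith
    · -- past the freeze the wall is `a₀ < B`
      have hlt : weilPositivityThreshold < Real.log (N : ℝ) / 2 := by
        have h1 : Real.exp (2 * weilPositivityThreshold) < N := by
          have h2 : ((⌈Real.exp (2 * weilPositivityThreshold)⌉₊ : ℕ) : ℝ) < N := by exact_mod_cast hgt
          exact (Nat.le_ceil _).trans_lt h2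
        have h3 : 2 * weilPositivityThreshold < Real.log (N : ℝ) := by
          rw [Real.lt_log_iff_exp_lt ((Real.exp_pos _).trans h1)]
          exact h1
        linarith
      rw [wall_eq_threshold_of_lt hRH hlt] at hN
      linarith

/-- ANY divergent minorant met infinitely often gives RH: if `f → ∞` and `f N ≤ W(N)` frequently, then RH.
[this track (theory-1)] -/
theorem riemannHypothesis_of_frequently_le_wall {f : ℕ → ℝ} (hf : Tendsto f atTop atTop)
    (h : ∃ᶠ N in atTop, f N ≤ weilSemilocalThreshold (Nat.primesBelow N)) : Summit.RiemannHypothesis := by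
  refine riemannHypothesis_iff_forall_exists_le_wall.2 fun T ↦ ?_
  obtain ⟨N, hN1, hN2⟩ := ((hf.eventually_ge_atTop T).and_frequently h).exists
  exact ⟨N, hN1.trans hN2⟩

/-- Under RH the walls dominate `(log N)/2` for every `N ≥ 1`. [cite: Bombieri2000Weil, Thm. 2; Yoshida1992HermitianForms, Prop. 6 (p. 320)] -/
theorem log_half_le_wall_of_riemannHypothesis (hRH : Summit.RiemannHypothesis) (hN : 1 ≤ N) :
    Real.log (N : ℝ) / 2 ≤ weilSemilocalThreshold (Nat.primesBelow N) := by
  obtain ⟨M, rfl⟩ : ∃ M, N = M + 1 := ⟨N - 1, (Nat.sub_add_cancel hN).symm⟩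
  push_cast
  exact riemannHypothesis_iff_forall_le_weilSemilocalThreshold.1 hRH M

/-- **RH ⟺ THE WALLS TEND TO INFINITY.** [this track (theory-1); Yoshida1992HermitianForms, Prop. 6 (p. 320)] -/
theorem riemannHypothesis_iff_tendsto_wall_atTop :
    Summit.RiemannHypothesis ↔
      Tendsto (fun N : ℕ ↦ weilSemilocalThreshold (Nat.primesBelow N)) atTop atTop := by
  constructor
  · intro hRH
    have hlog : Tendsto (fun N : ℕ ↦ Real.log (N : ℝ) / 2) atTop atTop :=
      (Real.tendsto_log_atTop.comp tendsto_natCast_atTop_atTop).atTop_div_const (by norm_num)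
    refine tendsto_atTop_mono' atTop ?_ hlog
    exact eventually_atTop.2 ⟨1, fun N hN ↦ log_half_le_wall_of_riemannHypothesis hRH hN⟩
  · intro h
    exact riemannHypothesis_iff_forall_exists_le_wall.2 fun T ↦ (h.eventually_ge_atTop T).exists

/-- **UNCONDITIONAL DICHOTOMY**: RH, or the wall sequence is eventually IDENTICALLY `a₀`. [cite: Yoshida1992HermitianForms, Prop. 6 (p. 320)] -/
theorem riemannHypothesis_or_wall_eventually_eq_threshold :
    Summit.RiemannHypothesis ∨
      ∃ N₀ : ℕ, ∀ N ≥ N₀, weilSemilocalThreshold (Nat.primesBelow N) = weilPositivityThreshold := by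
  by_cases hRH : Summit.RiemannHypothesis
  · exact Or.inl hRH
  refine Or.inr ⟨⌈Real.exp (2 * weilPositivityThreshold)⌉₊ + 1, fun N hN ↦ wall_eq_threshold_of_lt hRH ?_⟩
  have h1 : Real.exp (2 * weilPositivityThreshold) < N := by
    have h2 : ((⌈Real.exp (2 * weilPositivityThreshold)⌉₊ : ℕ) : ℝ) < N := by exact_mod_cast hN
    exact (Nat.le_ceil _).trans_lt h2
  have h3 : 2 * weilPositivityThreshold < Real.log (N : ℝ) := by
    rw [Real.lt_log_iff_exp_lt ((Real.exp_pos _).trans h1)]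
    exact h1
  linarith

/-- **RH ⟺ THE WALL SEQUENCE IS NOT EVENTUALLY CONSTANT.** [this track (theory-1); Yoshida1992HermitianForms, Prop. 6 (p. 320)] -/
theorem riemannHypothesis_iff_not_wall_eventuallyConst :
    Summit.RiemannHypothesis ↔
      ¬ ∃ a : ℝ, ∃ N₀ : ℕ, ∀ N ≥ N₀, weilSemilocalThreshold (Nat.primesBelow N) = a := by
  constructor
  · rintro hRH ⟨a, N₀, ha⟩
    have ht := riemannHypothesis_iff_tendsto_wall_atTop.1 hRH
    obtain ⟨N, hN1, hN2⟩ := ((ht.eventually_ge_atTop (a + 1)).and (eventually_ge_atTop N₀)).exists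
    have := ha N hN2
    linarith
  · intro h
    rcases riemannHypothesis_or_wall_eventually_eq_threshold with hRH | ⟨N₀, hN₀⟩
    · exact hRH
    · exact absurd ⟨weilPositivityThreshold, N₀, hN₀⟩ h

/-- Prime-indexed form (the A4 table's rows): **`RH ↔ ∀ T, ∃ q prime, T ≤ a*(S_q)`**. [this track (theory-1); Bombieri2000Weil, Thm. 2] -/
theorem riemannHypothesis_iff_forall_exists_prime_le_wall :
    Summit.RiemannHypothesis ↔
      ∀ T : ℝ, ∃ q : ℕ, q.Prime ∧ T ≤ weilSemilocalThreshold (Nat.primesBelow q) := by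
  constructor
  · intro hRH T
    obtain ⟨q, hqK, hq⟩ := Nat.exists_infinite_primes (⌈Real.exp (2 * T)⌉₊ + 1)
    refine ⟨q, hq, (le_log_half_ceil_exp T).trans (le_trans ?_ (log_half_le_wall_of_riemannHypothesis hRH hq.one_lt.le))⟩
    have h0 : (0 : ℝ) < (⌈Real.exp (2 * T)⌉₊ : ℝ) + 1 := by positivity
    have h1 : ((⌈Real.exp (2 * T)⌉₊ : ℕ) : ℝ) + 1 ≤ q := by exact_mod_cast hqK
    linarith [Real.log_le_log h0 h1]
  · intro h
    exact riemannHypothesis_iff_forall_exists_le_wall.2 fun T ↦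
      let ⟨q, _, hq⟩ := h T; ⟨q, hq⟩

/-! ## §4 First-gap locality (RH-free) and the landscape under the upper clause -/

/-- Every finite set of naturals misses a least prime: `∃ q` prime, `q ∉ S`, all smaller primes in `S`. [folklore] -/
theorem exists_firstGap (S : Finset ℕ) : ∃ q : ℕ, q.Prime ∧ q ∉ S ∧ ∀ p < q, p.Prime → p ∈ S := by
  classical
  have hex : ∃ q : ℕ, q.Prime ∧ q ∉ S := by
    obtain ⟨q, hqK, hq⟩ := Nat.exists_infinite_primes (S.sup id + 1)
    refine ⟨q, hq, fun hqS ↦ ?_⟩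
    have : q ≤ S.sup id := Finset.le_sup (f := id) hqS
    omega
  refine ⟨Nat.find hex, (Nat.find_spec hex).1, (Nat.find_spec hex).2, fun p hp hpp ↦ ?_⟩
  by_contra hpS
  exact Nat.find_min hex hp ⟨hpp, hpS⟩

/-- **FIRST-GAP LOCALITY** (RH-free): if `q` is prime, every prime `< q` lies in `S`, `q ∉ S`, and the UPPER clause
`a*(S_q) < (log q⁺)/2` holds at `q`, then `a*(S) = a*(S_q)` — the wall of `S` is the wall of its initial segment.
(Below `(log q⁺)/2` the two forms see the same prime powers; locality `weilSemilocalThreshold_congr`.)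
[cite: ConnesConsani2023, §2.1.2 (only the primes p < λ² enter the semi-local form)] -/
theorem weilSemilocalThreshold_eq_of_firstGap (hq : q.Prime) (hS : ∀ p < q, p.Prime → p ∈ S) (hqS : q ∉ S)
    (hUC : weilSemilocalThreshold (Nat.primesBelow q) < Real.log (nextPrime q) / 2) :
    weilSemilocalThreshold S = weilSemilocalThreshold (Nat.primesBelow q) := by
  have h1 := (nextPrime_prime q).one_lt.le
  refine weilSemilocalThreshold_congr (N := nextPrime q - 1) (fun n hn hpp ↦ ?_) ?_
  · -- a prime power `n ≤ q⁺ − 1` has its prime `p ≤ q`; `p ∈ S_q ↔ p < q ↔ p ∈ S`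
    obtain ⟨p, k, hp, hk, rfl⟩ := (isPrimePow_nat_iff _).1 hpp
    rw [Nat.primeFactors_prime_pow hk.ne' hp, Finset.singleton_subset_iff, Finset.singleton_subset_iff,
      Nat.mem_primesBelow]
    have hple : p ≤ q := by
      by_contra hlt
      rw [not_le] at hlt
      have h2 := nextPrime_le hp hlt
      have h3 : p ≤ p ^ k := Nat.le_self_pow hk.ne' p
      omega
    rcases hple.eq_or_lt with rfl | hlt
    · exact ⟨fun h ↦ absurd h.1 (lt_irrefl _), fun h ↦ absurd h hqS⟩
    · exact ⟨fun _ ↦ hS p hlt hp, fun _ ↦ ⟨hlt, hp⟩⟩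
  · rwa [show ((nextPrime q - 1 : ℕ) : ℝ) + 1 = nextPrime q by exact_mod_cast Nat.sub_add_cancel h1]

/-- Under the UPPER clause at every prime (`∀ q prime, a*(S_q) < (log q⁺)/2` — RH-free; CERTIFIED as data for
`5 ≤ q ≤ 73`, kernel for `q ≤ 13`, OPEN beyond; a named hypothesis here), EVERY finite `S` has the wall of some
initial segment: the semi-local landscape IS the wall sequence. [this track (theory-1)] -/
theorem exists_prime_weilSemilocalThreshold_eq_of_upperClause
    (hUC : ∀ q : ℕ, q.Prime → weilSemilocalThreshold (Nat.primesBelow q) < Real.log (nextPrime q) / 2)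
    (S : Finset ℕ) : ∃ q : ℕ, q.Prime ∧ weilSemilocalThreshold S = weilSemilocalThreshold (Nat.primesBelow q) := by
  obtain ⟨q, hq, hqS, hS⟩ := exists_firstGap S
  exact ⟨q, hq, weilSemilocalThreshold_eq_of_firstGap hq hS hqS (hUC q hq)⟩

/-- **Under the upper clause, `RH ↔ sup {a*(S) : S finite} = ∞`** (`↔ ∀ T, ∃ S, T ≤ a*(S)`). [this track (theory-1)] -/
theorem riemannHypothesis_iff_forall_exists_finset_le_wall_of_upperClause
    (hUC : ∀ q : ℕ, q.Prime → weilSemilocalThreshold (Nat.primesBelow q) < Real.log (nextPrime q) / 2) :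
    Summit.RiemannHypothesis ↔ ∀ T : ℝ, ∃ S : Finset ℕ, T ≤ weilSemilocalThreshold S := by
  constructor
  · intro hRH T
    obtain ⟨N, hN⟩ := riemannHypothesis_iff_forall_exists_le_wall.1 hRH T
    exact ⟨_, hN⟩
  · intro h
    refine riemannHypothesis_iff_forall_exists_le_wall.2 fun T ↦ ?_
    obtain ⟨S, hS⟩ := h T
    obtain ⟨q, _, hq⟩ := exists_prime_weilSemilocalThreshold_eq_of_upperClause hUC S
    exact ⟨q, hS.trans_eq hq⟩

/-- Under the upper clause the walls are STRICTLY increasing across every holding increment: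
`UC(q) ∧ H(q) → a*(S_q) < a*(S_{q⁺})`. [this track (theory-1)] -/
theorem wall_lt_wall_nextPrime_of_upperClause (hq : q.Prime)
    (hUC : weilSemilocalThreshold (Nat.primesBelow q) < Real.log (nextPrime q) / 2) (hH : HandoffH q) :
    weilSemilocalThreshold (Nat.primesBelow q) < weilSemilocalThreshold (Nat.primesBelow (nextPrime q)) :=
  hUC.trans_le ((handoffH_iff_wallOffset hq).1 hH)

end HandoffDecomposition

end Summit.RiemannHypothesis.RiemannHypothesis.Theorems

end
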